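import Mathlib
import Summits.CriticalPhenomena.CardyFormulaZ2.Theorems.CardySelfRefinementGradientComparabilityOfMonotoneLine
import Summits.CriticalPhenomena.CardyFormulaZ2.Theorems.CardySelfRefinementGradientComparabilityOfMonotoneLineW
import Summits.CriticalPhenomena.CardyFormulaZ2.Theorems.CardySelfRefinementGradientComparabilityStubMonotoneRep
import Summits.CriticalPhenomena.CardyFormulaZ2.Theorems.CardySelfRefinementGradientComparabilityStubLevelSetTransport
import Summits.CriticalPhenomena.CardyFormulaZ2.Theorems.CardySelfRefinementGradientComparabilityStubWindowAtRhoZero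
import Summits.CriticalPhenomena.CardyFormulaZ2.Theorems.CardySelfRefinementGradientComparabilityStubCornerPatchReduction
import Summits.CriticalPhenomena.CardyFormulaZ2.Theorems.CardySelfRefinementGradientComparabilityStubSlopeBoundsBulkAssembly
import Summits.CriticalPhenomena.CardyFormulaZ2.Theorems.CardySelfRefinementGradientComparabilityStubSlopeBoundsCRange
import Summits.CriticalPhenomena.CardyFormulaZ2.Theorems.CardySelfRefinementGradientComparabilityStubSlopeBoundsLayerReduction
import Summits.CriticalPhenomena.CardyFormulaZ2.Theorems.CardySelfRefinementGradientComparabilityStubSlopeBoundsCorner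
import Summits.CriticalPhenomena.CardyFormulaZ2.Theorems.CardySelfRefinementGradientComparabilityStubSlopeBoundsCornerConfinement
import Summits.CriticalPhenomena.CardyFormulaZ2.Theorems.CardySelfRefinementGradientComparabilityStubCornerHardWayBoxes
import Summits.CriticalPhenomena.CardyFormulaZ2.Theorems.CardySelfRefinementGradientComparabilityStubSlopeBoundsCornerSDAssembly3
import HarnessLib

/-!
# Crux `GradientComparability` (stmt-CriticalPhenomena-10269) — line `monotone-product-coordinates`: skeleton r7

Route `CardySelfRefinement`, sub-problem `CriticalPhenomena/CardyFormulaZ2`; crux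
`Summit.CriticalPhenomena.CardyFormulaZ2.Theses.CardySelfRefinement.GradientComparability` (rank 5).
Planner `planner-cruxplan-stmt-CriticalPhenomena-10269-monotone-product-coo-0` (r1, 2026-08-17); lead a1
(prover-line-stmt-CriticalPhenomena-10269-a1-0) reshapes r2/r3 (2026-08-17).  Card
`Cruxes/GradientComparability/Ideas/monotone-product-coordinates.md` (ideator 4, r2), MERGED with the level-curve
log-gradient identity (★) of the sibling cards (`TRIAGE-r2-1.md`, `TRIAGE-r2-2.md`).  Informal statements, sizes,
sources, barriers: `Lines/monotone-product-coordinates.md`.  Vocabulary `ax tb opn cfg prm M A P Dρ Dc PathOK window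
edgeOf Aloc` from `Theorems/CardySelfRefinementDefs` (definitionally the route's `let`-chain).

STATE r3 (what is LANDED in `Theorems/`, all `--supports stmt-CriticalPhenomena-10269`, kernel-accepted):
* `stub_monotoneRep` — `…StubMonotoneRep.lean` (p142128; blocks criterion `…StubMonotoneRepBlocks.lean` p141523);
* `stub_levelSetTransport` — `…StubLevelSetTransport.lean` (p139940; `…Leaf` p139512, `…Corner` p139784);
* the COMPOSITION `GradientComparability_of_monotoneLine` — `…OfMonotoneLine.lean` (p142722; charts
  `…OfMonotoneLineCharts.lean` p141441): the six registered stub signatures imply the crux BY NAME;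
* REDUCTIONS of the two Kesten-class stubs to pure near-critical-window statements about explicit PRODUCT measures:
  `stub_windowAtRhoZero_of_sliceStability` (+ converse `sliceStability_of_windowAtRhoZero`) — `…StubWindowAtRhoZero.lean`
  (p141185); `stub_cornerPatch_of_sliceWindows` — `…StubCornerPatchReduction.lean` (p141084; shadow dictionary
  `…StubCornerPatchShadow.lean` p141450);
* slope-bounds ingredients: `…StubSlopeBoundsBundle.lean` (p141399), Stage A `Drho_abs_le_sum_axial_pivotal`
  (`…StubSlopeBoundsStageA.lean` p142276), finite energy of `M_k` (`…StubSlopeBoundsFiniteEnergy.lean` p142713),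
  modification cost (`…StubSlopeBoundsModification.lean`, p144399 pending), Stage B bulk transfer (written).
RESHAPE r3: `stub_windowAtRhoZero` and `stub_cornerPatch` are DISCHARGED below from two NEW registered stubs stated on
the product measures themselves — `stub_sliceKesten` (Kesten 1987 Thm 1/Lemma 8 for the `k`-periodic inhomogeneous
INDEPENDENT bond model on the slice `ρ = 0`) and `stub_cornerWindows` (the two Kesten windows through the independent
corner `(1,0)`: coarse Bernoulli on `{c = 0}`, tied bundles + Bernoulli(`c`) cell interiors on `{ρ = 1}`).  Open stubs
(5 `sorry`s): `stub_slopeBounds`, `stub_bet` (THE BET — open conjecture, lead), `stub_cornerBet` (corner BET — open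
conjecture), `stub_sliceKesten`, `stub_cornerWindows` (Bernoulli-class Kesten debts; the tree's
`Literature.Probability.Percolation.Kesten1987_zdFourArmStability` / `…PivotalCount_sameParam` are the unproved
homogeneous cousins).

RESHAPE r4 (lead a1, 2026-08-17 ~09:30Z): `stub_slopeBounds` is DISCHARGED below from three NEW registered stubs by the
landed reductions of wave 3 — BULK clause: `slopeBounds_bulk_of_cRange_of_layerBound` (p146372) ⨉ `bulkPathPoints_cRange`
((C), p146555) ⨉ `axialLayer_pivotal_le_of_layerModification` ((D) ⟸ a deterministic layer surgery, p150676) with the new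
stub `stub_layerLocalModification`; CORNER clause: `slopeBounds_corner_of_localSlope_of_confinement` (p146673) ⨉
`cornerConfinement_of_hardWayBoxes` (p147063) with the new stubs `stub_cornerLocalSlope` (near-critical local comparison
`|Dc| ≤ C|Dρ|` for `c ≤ c₀` on the corner band) and `stub_cornerHardWayBoxes` (Aizenman–Grimmett supercriticality of the
interior enhancement just inside the corner).  Open stubs (7 `sorry`s = stubs_max): `stub_bet`, `stub_cornerBet`
(conjectures); `stub_sliceKesten`, `stub_cornerWindows` (Kesten-class; blueprints `Lines/…-sliceKesten-blueprint.md`,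
`…-cornerWindows-blueprint.md`; partial assemblies landed p147424, p147991, p149962); `stub_layerLocalModification`
(planar lattice topology, ≈ 3 kLoC, report `Lines/…-axialLayer-report.md`), `stub_cornerLocalSlope`, `stub_cornerHardWayBoxes`
(report `Lines/…-slopeBoundsCorner-report.md`; partial reductions p146673, p147063, p147504).

RESHAPE r5 (lead a1, 2026-08-17 ~11:40Z): the corner BET is re-registered in its WEAKEST CONSUMED FORM (W) as `stub_cornerBetW`
(pointwise: `Dρ ≠ 0` on the corner band and `|∂ρ(Dc/Dρ)| ≤ Θ` there, mesh-uniformly; `Lines/…-cornerBet-reshape.md`), composed through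
the landed `GradientComparability_of_monotoneLineW` (p153244; transport `stub_levelSetTransport_of_pointwiseCornerBet` p152361).
For THE BET the landed drop-in for the weaker INTEGRATED form is `GradientComparability_of_monotoneLineInt` (p153210; transport
`levelSetTransport_bulk_of_intBet` p152708): the planner may file ∫BET (the sibling line's `stub_intBet`) instead of `stub_bet`.
Wave-4 bricks landed toward the other stubs: layer topology `quadCarrier_cell_or_bridge` (p153717), `crosscut_sides_and_pockets`
(p154075); (HWB) coarse endpoint `hardWayBoxes_one_of_half_lt` (p153759); (LOC) penalty half of the signed domination
`Drho_add_mul_Dc_ge_of_far` (p157493; p153442 p154194 p154694 p155591); cornerWindows S2 `sum_real_section_sdiff_eq_pivotal_of_far_c0`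
(p153251).

RESHAPE r6 (lead a1, 2026-08-17 ~13:45Z): `stub_cornerHardWayBoxes` is **CLOSED** — `Theorems/…StubCornerHardWayBoxes.lean` (p163128) =
assembly `stub_cornerHardWayBoxes_of_sharedLeInterior` (p161433: coarse endpoint p153759 ⨉ ρ-leg p158943 ⨉ segment integration p159599)
applied to the Aizenman–Grimmett interior-bypass inequality `shared_le_mul_interior` (p162985; walk/geom/measure bricks p162354 p162555
p162778).  SIX `sorry`s remain: `stub_bet`, `stub_cornerBetW` (conjectures), `stub_sliceKesten`, `stub_cornerWindows` (Kesten class;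
global reduction `stub_cornerWindows_of_inputs` p161960: (K0),(K1) windows + (D0π),(D1∂) boundary counts + (LOC) + (HWB, now proved)),
`stub_layerLocalModification` (topology; (S1)(S3)(S4) landed p153717 p160624 p162922), `stub_cornerLocalSlope` ((LOC); k = 2 reduced to the
boundary-layer statement (LAYER₂) by `cornerSignedDomination_two_of_layerTerms` p161876).

RESHAPE r7 (lead a1, 2026-08-17 ~15:30Z): `stub_cornerLocalSlope` is DISCHARGED from two NEW registered stubs `stub_cornerLayer2` /
`stub_cornerLayer3` (the boundary-LAYER counts of the corner band for `k = 2` / `k = 3`: defect mass of the non-far selectors + pivotal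
mass of the non-far interior edges ≤ θ·N_far, θ < 1) by the landed `cornerLocalSlope_of_layerTerms` (p166125: penalty half p157493,
corner transfers k = 2 p160580 / k = 3 p165774, assemblies p161876 / p166125).  Layer-surgery bricks landed for `stub_layerLocalModification`:
free-cell transfer `layer_transfer_of_freeCell` (p165797), bridge transfer `layer_bridgeTransfer_of_cellContact` (p165749) — residue: the
degenerate contacts (G1), multi-quad interference (G2) and the coarse-end residual of (S5) (`Lines/…-layer-topology-report.md` §wave7).
SEVEN `sorry`s: `stub_bet`, `stub_cornerBetW`, `stub_sliceKesten`, `stub_cornerWindows`, `stub_layerLocalModification`,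
`stub_cornerLayer2`, `stub_cornerLayer3`.

THE CRUX.  For `k ∈ {2,3}`, every RSW path `γ : (1,0) → (0,½)` of the self-refinement model `M_k(ρ,c)`
and every nonempty finite quad family `F`, the Russo-gradient size `G = |∂ρP| + |∂cP|` at mesh `η` is
(i) comparable up to ONE constant between any two path points at equal small mesh and (ii) → +∞
uniformly along the path.

THE LINE.  Two levers and one piece of Kesten theory, none about a window of a DEPENDENT law:
* COORDINATES (this card).  The `k`-tuple law of a bundle, `ρ·δ_{fair shared} + (1−ρ)·Ber(½)^{⊗k}`, IS
  the law of `X_i = a ∨ (d′ ∧ b_i)` for INDEPENDENT coins `a ~ Ber(ρ/2)` (force-open),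
  `d′ ~ Ber((2−2ρ)/(2−ρ))` (not-force-closed), `b_i ~ Ber(½)`: `M_k(ρ,c) = (prodBernoulli prm′).map cfg′`
  with a COORDINATEWISE MONOTONE read-out (`stub_monotoneRep`; finite core checked below:
  `tuple_allOpen/_mixed/_allClosed`, `cfg'_mono`).  Hence Russo holds in EVERY direction with genuine
  pivotals, `∂ρP = ½·N_a − 2(2−ρ)⁻²·N_{d′}`, which makes the first-order SLOPE BOUNDS (`stub_slopeBounds`:
  `|∂ρP| ≤ C_δ ∂cP` at bulk path points, `|∂cP| ≤ C′|∂ρP|` on the corner band) a chain-of-flips +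
  local-modification statement, and makes the near-corner Kesten window a window of ONE independent
  coin model at its Bernoulli point `(α,δ′,c) = (½,0,0)` with three MONOTONE legs (`stub_cornerPatch`).
* IDENTITY (★) (sibling cards).  `d/dρ log ∂cP(ρ, ℓ_v(ρ)) = ∂_c(∂ρP/∂cP)` along every finite-size level
  curve (twin: `d/dc log|∂ρP| = ∂_ρ(∂cP/∂ρP)`), so THE BET (`stub_bet`, the registered signature of
  `Sketch.stub_transversalSlopeLipschitz` VERBATIM — one conjecture, filed once, shared with
  `TrivialSectorRate`) and its corner twin (`stub_cornerBet`) transport the gradient INSIDE ONE LEVEL SET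
  to the slice `ρ = 0` (bulk) or to the slices `{c = 0} ∪ {ρ = 1}` (corner): `stub_levelSetTransport`.
* KESTEN only where the law is a product measure: `stub_windowAtRhoZero` (the independent `k`-periodic
  inhomogeneous bond model `M_k(0,·)`) and `stub_cornerPatch` (the two slices through `(1,0)`).

The LANDED `GradientComparability_of_monotoneLine` composes the stubs into the crux BY NAME (bulk chart:
slope bound + level-set comparability + window at `ρ = 0`, same-level points on the slice by the
intermediate value theorem; corner chart: slope bound + level-set comparability + patch, same-level
points on the two slices by the IVT; overlap of the charts on `ρ ∈ [1−2δ, 1−δ]` (IVT along the path);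
clause (ii) from clause (i) and the landed `divergesAt_zero_half`).  What died in line `Sketch`
(W = `stub_Dc_windowStability`, R = `stub_Drho_le_window`, CORNER = `stub_cornerTwoCharts`: Kesten theory
for the 1-dependent `M_k(ρ,·)`) does NOT reappear: W survives only at `ρ = 0` (independent), R is
eliminated by (★), CORNER splits into corner-BET + independent patch.
-/

noncomputable section

namespace Summit.CriticalPhenomena.CardyFormulaZ2.Cruxes.GradientComparability.MonotoneProductCoordinates

open scoped Topology
open Filter Set MeasureTheory
open Literature.Probability.LatticeModels Literature.Probability.Percolation
open Literature.Probability.Percolation.QuadCrossing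
open Summit.CriticalPhenomena.CardyFormulaZ2.Theses.CardySelfRefinement
open Summit.CriticalPhenomena.CardyFormulaZ2.Theorems.CardySelfRefinement

/-! ## §1 The monotone product coordinates (vocabulary local to the line; the REGISTERED signatures
below inline these bodies, so a prover needs only `Theorems/CardySelfRefinementDefs`) -/

/-- Coin biases in monotone coordinates: slot `0` = own coin of the fine edge (fair if axial, `c`
otherwise — unchanged), slot `1` = the FORCE-OPEN coin `a` of a bundle (bias `ρ/2`), slot `2` = the
NOT-FORCE-CLOSED coin `d′` of a bundle (bias `(2−2ρ)/(2−ρ) ∈ [0,1]` for `ρ ∈ [0,1]`). -/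
abbrev prm' (k : ℕ) (ρ c : ℝ) (i : Site 2 × Fin 2 × Fin 3) : unitInterval :=
  if i.2.2 = 0 then (if ax k (i.1, i.2.1) then half else Set.projIcc (0 : ℝ) 1 zero_le_one c)
  else if i.2.2 = 1 then Set.projIcc (0 : ℝ) 1 zero_le_one (ρ / 2)
  else Set.projIcc (0 : ℝ) 1 zero_le_one ((2 - 2 * ρ) / (2 - ρ))

/-- Monotone read-out: an axial edge is open iff `a ∨ (d′ ∧ b)`; a non-axial edge iff its own coin. -/
abbrev opn' (k : ℕ) (S : Set (Site 2 × Fin 2 × Fin 3)) (e : Site 2 × Fin 2) : Prop :=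
  if ax k e then ((tb k e, e.2, (1 : Fin 3)) ∈ S ∨ ((tb k e, e.2, (2 : Fin 3)) ∈ S ∧ (e.1, e.2, (0 : Fin 3)) ∈ S))
  else (e.1, e.2, (0 : Fin 3)) ∈ S

/-- Coins `↦` bond configuration, monotone version of the route's `cfg`. -/
abbrev cfg' (k : ℕ) (S : Set (Site 2 × Fin 2 × Fin 3)) : BondConfig (Site 2) :=
  {e | ∃ (v : Site 2) (d : Fin 2), e = s(v, v + (if d = 0 then ![1, 0] else ![0, 1])) ∧ opn' k S (v, d)}

/-! ### Finite core of the coordinate change (checked): the bundle law and monotonicity -/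

/-- The key cancellation: `P(a = 0) · P(d′ = 1) = (1 − ρ/2) · (2−2ρ)/(2−ρ) = 1 − ρ`. -/
theorem dPrime_key (ρ : ℝ) (hρ : ρ ≠ 2) : (1 - ρ / 2) * ((2 - 2 * ρ) / (2 - ρ)) = 1 - ρ := by
  have h2 : (2 - ρ) ≠ 0 := sub_ne_zero.2 (Ne.symm hρ)
  rw [← mul_div_assoc, div_eq_iff h2]
  ring

/-- A non-constant open/closed pattern of the `k` sub-edges: `(1−α)·δ′·t = (1−ρ)·t`. -/
theorem tuple_mixed (ρ t : ℝ) (hρ : ρ ≠ 2) :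
    (1 - ρ / 2) * ((2 - 2 * ρ) / (2 - ρ)) * t = (1 - ρ) * t := by
  rw [dPrime_key ρ hρ]

/-- All `k` sub-edges open: `α + (1−α)·δ′·t = ρ/2 + (1−ρ)·t` (`α = ρ/2`, `δ′ = (2−2ρ)/(2−ρ)`,
`t = 2^{-k}`) — the route's "selector on ∧ shared on, or selector off ∧ all own coins on". -/
theorem tuple_allOpen (ρ t : ℝ) (hρ : ρ ≠ 2) :
    ρ / 2 + (1 - ρ / 2) * ((2 - 2 * ρ) / (2 - ρ)) * t = ρ / 2 + (1 - ρ) * t := by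
  rw [dPrime_key ρ hρ]

/-- All `k` sub-edges closed: `(1−α)(1−δ′) + (1−α)·δ′·t = ρ/2 + (1−ρ)·t`. -/
theorem tuple_allClosed (ρ t : ℝ) (hρ : ρ ≠ 2) :
    (1 - ρ / 2) * (1 - (2 - 2 * ρ) / (2 - ρ)) + (1 - ρ / 2) * ((2 - 2 * ρ) / (2 - ρ)) * t =
      ρ / 2 + (1 - ρ) * t := by
  rw [mul_sub, mul_one, dPrime_key ρ hρ]
  ring

/-- The bias of `d′` is a genuine probability on `ρ ∈ [0,1]` (no `projIcc` clamping occurs). -/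
theorem dPrime_mem_Icc {ρ : ℝ} (hρ : ρ ∈ Set.Icc (0 : ℝ) 1) :
    (2 - 2 * ρ) / (2 - ρ) ∈ Set.Icc (0 : ℝ) 1 := by
  have h2 : 0 < 2 - ρ := by linarith [hρ.2]
  constructor
  · exact div_nonneg (by linarith [hρ.2]) h2.le
  · rw [div_le_one h2]; linarith [hρ.1]

/-- Russo coefficient of the `d′`-direction: `d/dρ (2−2ρ)/(2−ρ) = −2/(2−ρ)²`, so
`∂ρP = ½·N_a − 2(2−ρ)⁻²·N_{d′}` (signed pair of genuine coin-pivotal sums). -/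
theorem hasDerivAt_dPrime {ρ : ℝ} (hρ : ρ ≠ 2) :
    HasDerivAt (fun x : ℝ => (2 - 2 * x) / (2 - x)) (-2 / (2 - ρ) ^ 2) ρ := by
  have h2 : (2 - ρ) ≠ 0 := sub_ne_zero.2 (Ne.symm hρ)
  have hn : HasDerivAt (fun x : ℝ => 2 - 2 * x) (-2) ρ := by
    simpa using ((hasDerivAt_id ρ).const_mul 2).const_sub 2
  have hd : HasDerivAt (fun x : ℝ => 2 - x) (-1) ρ := by
    simpa using (hasDerivAt_id ρ).const_sub 2
  refine (hn.div hd h2).congr_deriv ?_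
  have h3 : (2 - ρ) ^ 2 ≠ 0 := pow_ne_zero 2 h2
  rw [div_eq_div_iff h3 h3]
  ring

/-- The read-out is coordinatewise monotone (every coin occurs positively): crossing events pull back
to INCREASING coin cylinders, so Russo/BK/increasing couplings apply in every direction. -/
theorem cfg'_mono (k : ℕ) : Monotone (cfg' k) := by
  intro S T hST e he
  obtain ⟨v, d, rfl, hop⟩ := he
  refine ⟨v, d, rfl, ?_⟩
  by_cases hax : ax k (v, d)
  · simp only [opn', hax, if_true] at hop ⊢
    rcases hop with h1 | ⟨h2, h0⟩
    · exact Or.inl (hST h1)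
    · exact Or.inr ⟨hST h2, hST h0⟩
  · simp only [opn', hax, if_false] at hop ⊢
    exact hST hop

/-! ## §2 The stub STATEMENTS (named `Prop`s over `CardySelfRefinementDefs` only) -/

/-- STUB 1 statement — **MONOTONE PRODUCT REPRESENTATION** (size M; provable now).  For
`ρ, c ∈ [0,1]` the route's law `M_k(ρ,c)` equals the push-forward of the product coin measure with
biases `prm′ k ρ c` under the monotone read-out `cfg′ k` (bodies inlined: `monotoneRep_iff`). -/
def MonotoneRep : Prop :=
  ∀ k : ℕ, ∀ ρ ∈ Set.Icc (0 : ℝ) 1, ∀ c ∈ Set.Icc (0 : ℝ) 1,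
    M k ρ c =
      (prodBernoulli (fun i : Site 2 × Fin 2 × Fin 3 =>
          if i.2.2 = 0 then (if ax k (i.1, i.2.1) then half else Set.projIcc (0 : ℝ) 1 zero_le_one c)
          else if i.2.2 = 1 then Set.projIcc (0 : ℝ) 1 zero_le_one (ρ / 2)
          else Set.projIcc (0 : ℝ) 1 zero_le_one ((2 - 2 * ρ) / (2 - ρ)))).map
        (fun S : Set (Site 2 × Fin 2 × Fin 3) =>
          ({e | ∃ (v : Site 2) (d : Fin 2), e = s(v, v + (if d = 0 then ![1, 0] else ![0, 1])) ∧
              (if ax k (v, d) then ((tb k (v, d), d, (1 : Fin 3)) ∈ S ∨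
                  ((tb k (v, d), d, (2 : Fin 3)) ∈ S ∧ (v, d, (0 : Fin 3)) ∈ S))
                else (v, d, (0 : Fin 3)) ∈ S)} : BondConfig (Site 2)))

/-- `MonotoneRep` in the line's vocabulary. -/
theorem monotoneRep_iff :
    MonotoneRep ↔ ∀ k : ℕ, ∀ ρ ∈ Set.Icc (0 : ℝ) 1, ∀ c ∈ Set.Icc (0 : ℝ) 1,
      M k ρ c = (prodBernoulli (prm' k ρ c)).map (cfg' k) :=
  Iff.rfl

/-- STUB 2 statement — **FIRST-ORDER SLOPE BOUNDS** (size L; bulk half landed in substance: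
`stub_nonAxialShare_bulk`, `local_modification`).  From the monotone representation:
(bulk) at path points with `ρ_s ≤ 1 − δ`, `|∂ρP| ≤ C_δ · ∂cP` mesh-uniformly (so `G ≍ ∂cP` there);
(corner) for some depth `δ ≤ ¼`, on the corner level band `{ρ ≥ 1 − 2δ, P_η ∈ [vlo,vhi]}`,
`|∂cP| ≤ C′ · |∂ρP|` mesh-uniformly (so `G ≍ |∂ρP|` there). -/
def SlopeBounds : Prop :=
  ∀ k : ℕ, k = 2 ∨ k = 3 → ∀ γ : unitInterval → ℝ × ℝ, PathOK k γ →
    ∀ (m : ℕ) (F : Fin m → Quad (Set.univ : Set ℂ)), 0 < m →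
      (∀ δ : ℝ, 0 < δ → δ ≤ 1 / 2 → ∃ C η₁ : ℝ, 0 < η₁ ∧ ∀ η ∈ Set.Ioo 0 η₁, ∀ s : unitInterval,
          (γ s).1 ≤ 1 - δ → |Dρ k m F η (γ s)| ≤ C * Dc k m F η (γ s)) ∧
      (∃ δ : ℝ, 0 < δ ∧ δ ≤ 1 / 4 ∧ ∀ vlo vhi : ℝ, 0 < vlo → vlo < vhi → vhi < 1 →
          ∃ C η₁ : ℝ, 0 < η₁ ∧ ∀ η ∈ Set.Ioo 0 η₁, ∀ ρ ∈ Set.Icc (1 - 2 * δ) 1,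
            ∀ c ∈ Set.Icc (0 : ℝ) 1, P k m F η ρ c ∈ Set.Icc vlo vhi →
              |Dc k m F η (ρ, c)| ≤ C * |Dρ k m F η (ρ, c)|)

/-- STUB 3 statement — **THE BET** (transversal slope bound), VERBATIM the registered signature of
`Sketch.stub_transversalSlopeLipschitz` (one conjecture, filed once; TSR-class; MC-supported:
`MC-BetVerdict.md`, `MC-BetVerdict-1dep.md`): in the bulk `ρ ≤ 1 − δ` the slope field `∂ρP/∂cP` is
`Θ`-Lipschitz in `c` across the level band, mesh-uniformly. -/
def TransversalSlopeLipschitz : Prop :=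
  ∀ k : ℕ, k = 2 ∨ k = 3 → ∀ γ : unitInterval → ℝ × ℝ, PathOK k γ →
    ∀ (m : ℕ) (F : Fin m → Quad (Set.univ : Set ℂ)), 0 < m → ∀ δ : ℝ, 0 < δ → δ ≤ 1 / 2 →
      ∀ vlo vhi : ℝ, 0 < vlo → vlo < vhi → vhi < 1 →
        ∃ Θ η₁ : ℝ, 0 ≤ Θ ∧ 0 < η₁ ∧ ∀ η ∈ Set.Ioo 0 η₁, ∀ ρ ∈ Set.Icc (0 : ℝ) (1 - δ),
          ∀ c ∈ Set.Icc (0 : ℝ) 1, ∀ c' ∈ Set.Icc (0 : ℝ) 1,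
            P k m F η ρ c ∈ Set.Icc vlo vhi → P k m F η ρ c' ∈ Set.Icc vlo vhi →
              |Dρ k m F η (ρ, c) / Dc k m F η (ρ, c) - Dρ k m F η (ρ, c') / Dc k m F η (ρ, c')| ≤
                Θ * |c - c'|

/-- STUB 4 statement — **THE CORNER BET** (`c`-chart twin of THE BET; MC-supported, card
`level-log-gradient-identity` jobs j021308/j021309): for some depth `δ ≤ ¼`, on the corner level band
`{ρ ≥ 1 − 2δ, P_η(·,c) ∈ [vlo,vhi]}` the `ρ`-derivative does not vanish and the inverse slope field
`∂cP/∂ρP` is `Θ′`-Lipschitz in `ρ` at fixed `c`, mesh-uniformly. -/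
def CornerSlopeLipschitz : Prop :=
  ∀ k : ℕ, k = 2 ∨ k = 3 → ∀ γ : unitInterval → ℝ × ℝ, PathOK k γ →
    ∀ (m : ℕ) (F : Fin m → Quad (Set.univ : Set ℂ)), 0 < m →
      ∃ δ : ℝ, 0 < δ ∧ δ ≤ 1 / 4 ∧ ∀ vlo vhi : ℝ, 0 < vlo → vlo < vhi → vhi < 1 →
        ∃ Θ η₁ : ℝ, 0 ≤ Θ ∧ 0 < η₁ ∧ ∀ η ∈ Set.Ioo 0 η₁, ∀ c ∈ Set.Icc (0 : ℝ) 1,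
          ∀ ρ ∈ Set.Icc (1 - 2 * δ) 1, ∀ ρ' ∈ Set.Icc (1 - 2 * δ) 1,
            P k m F η ρ c ∈ Set.Icc vlo vhi → P k m F η ρ' c ∈ Set.Icc vlo vhi →
              Dρ k m F η (ρ, c) ≠ 0 ∧
              |Dc k m F η (ρ, c) / Dρ k m F η (ρ, c) - Dc k m F η (ρ', c) / Dρ k m F η (ρ', c)| ≤
                Θ * |ρ - ρ'|

/-- STUB 5 statement — **KESTEN PATCH AT THE INDEPENDENT CORNER** (size L; Bernoulli-class).  On the
two parameter slices through `(1,0)` the law is a product-coin model with monotone read-out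
(`{c = 0}`: coarse Bernoulli bond-`kℤ²` in `p(ρ) = ρ/2 + (1−ρ)2^{-k}` — two monotone coin legs
`a ↑`, `d′ ↓`; `{ρ = 1}`: tied bundles + independent cell coins, monotone in `c`), and across their level
band `{P_η ∈ [vlo, vhi]}` (a Kesten window of the Bernoulli point `(α,δ′,c) = (½,0,0)`) the
`ρ`-derivative is comparable up to one mesh-uniform constant. -/
def CornerPatch : Prop :=
  ∀ k : ℕ, k = 2 ∨ k = 3 → ∀ (m : ℕ) (F : Fin m → Quad (Set.univ : Set ℂ)), 0 < m →
    ∀ vlo vhi : ℝ, 0 < vlo → vlo < vhi → vhi < 1 →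
      ∃ Λ η₁ : ℝ, 0 < η₁ ∧ ∀ η ∈ Set.Ioo 0 η₁,
        ∀ q ∈ Set.Icc (0 : ℝ) 1 ×ˢ Set.Icc (0 : ℝ) 1, ∀ q' ∈ Set.Icc (0 : ℝ) 1 ×ˢ Set.Icc (0 : ℝ) 1,
          (q.1 = 1 ∨ q.2 = 0) → (q'.1 = 1 ∨ q'.2 = 0) →
            P k m F η q.1 q.2 ∈ Set.Icc vlo vhi → P k m F η q'.1 q'.2 ∈ Set.Icc vlo vhi →
              |Dρ k m F η q| ≤ Λ * |Dρ k m F η q'|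

/-- STUB 6 conclusion — **LEVEL-SET COMPARABILITY** (what the identity (★) delivers from the two BETs and
the patch; size M–L, provable now modulo its hypotheses): two points of `[0,1−δ] × [0,1]` on the SAME
level `v ∈ [vlo,vhi]` have comparable `∂cP` (bulk); for some depth `δ ≤ ¼`, two points of
`[1−2δ,1] × [0,1]` on the same level have comparable `|∂ρP|` (corner); mesh-uniformly. -/
def LevelSetComparability : Prop :=
  ∀ k : ℕ, k = 2 ∨ k = 3 → ∀ γ : unitInterval → ℝ × ℝ, PathOK k γ →
    ∀ (m : ℕ) (F : Fin m → Quad (Set.univ : Set ℂ)), 0 < m →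
      (∀ δ : ℝ, 0 < δ → δ ≤ 1 / 2 → ∀ vlo vhi : ℝ, 0 < vlo → vlo < vhi → vhi < 1 →
        ∃ Λ η₁ : ℝ, 0 < η₁ ∧ ∀ η ∈ Set.Ioo 0 η₁,
          ∀ ρ₀ ∈ Set.Icc (0 : ℝ) (1 - δ), ∀ c₀ ∈ Set.Icc (0 : ℝ) 1,
          ∀ ρ₁ ∈ Set.Icc (0 : ℝ) (1 - δ), ∀ c₁ ∈ Set.Icc (0 : ℝ) 1,
            P k m F η ρ₀ c₀ ∈ Set.Icc vlo vhi → P k m F η ρ₁ c₁ = P k m F η ρ₀ c₀ →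
              Dc k m F η (ρ₁, c₁) ≤ Λ * Dc k m F η (ρ₀, c₀)) ∧
      (∃ δ : ℝ, 0 < δ ∧ δ ≤ 1 / 4 ∧ ∀ vlo vhi : ℝ, 0 < vlo → vlo < vhi → vhi < 1 →
        ∃ Λ η₁ : ℝ, 0 < η₁ ∧ ∀ η ∈ Set.Ioo 0 η₁,
          ∀ ρ₀ ∈ Set.Icc (1 - 2 * δ) 1, ∀ c₀ ∈ Set.Icc (0 : ℝ) 1,
          ∀ ρ₁ ∈ Set.Icc (1 - 2 * δ) 1, ∀ c₁ ∈ Set.Icc (0 : ℝ) 1,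
            P k m F η ρ₀ c₀ ∈ Set.Icc vlo vhi → P k m F η ρ₁ c₁ = P k m F η ρ₀ c₀ →
              |Dρ k m F η (ρ₁, c₁)| ≤ Λ * |Dρ k m F η (ρ₀, c₀)|)

/-- STUB 7 statement — **KESTEN WINDOW ON THE INDEPENDENT SLICE `ρ = 0`** (size L; Bernoulli-class:
Kesten 1987 Lemma 8 / (4.5) for the `k`-periodic inhomogeneous INDEPENDENT bond model, axial edges
at `½`, non-axial at `c`): across the level window `{c : P_η(0,c) ∈ [vlo,vhi]}` the Russo derivative
`∂cP(0,·)` varies by at most a mesh-uniform factor. -/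
def WindowAtRhoZero : Prop :=
  ∀ k : ℕ, k = 2 ∨ k = 3 → ∀ (m : ℕ) (F : Fin m → Quad (Set.univ : Set ℂ)), 0 < m →
    ∀ vlo vhi : ℝ, 0 < vlo → vlo < vhi → vhi < 1 →
      ∃ Λ η₁ : ℝ, 0 < η₁ ∧ ∀ η ∈ Set.Ioo 0 η₁, ∀ c ∈ Set.Icc (0 : ℝ) 1, ∀ c' ∈ Set.Icc (0 : ℝ) 1,
        P k m F η 0 c ∈ Set.Icc vlo vhi → P k m F η 0 c' ∈ Set.Icc vlo vhi →
          Dc k m F η (0, c) ≤ Λ * Dc k m F η (0, c')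

/-! ## §3 The registered stubs (`sorry` lives only here) and the discharged ones

Lead a1 reshape r1 (2026-08-17): hypotheses of `stub_slopeBounds` / `stub_levelSetTransport` INLINED verbatim in the
registered signatures (workers state them over `CardySelfRefinementDefs` alone).  r2: `stub_levelSetTransport` landed.
r3: `stub_monotoneRep` landed; `stub_windowAtRhoZero` / `stub_cornerPatch` discharged from the NEW registered stubs
`stub_sliceKesten` / `stub_cornerWindows` by the landed reductions; the composition is the landed
`GradientComparability_of_monotoneLine`. -/

/-- **STUB 1 · `stub_monotoneRep`** — **LANDED** (`Theorems/…StubMonotoneRep.lean`, p142128): `M_k(ρ,c)` is the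
push-forward of the product coin measure with biases (own: `½`/`c`; force-open `a`: `ρ/2`; not-force-closed `d′`:
`(2−2ρ)/(2−ρ)`) under the monotone read-out `a ∨ (d′ ∧ b)` / own coin. -/
theorem stub_monotoneRep :
    ∀ k : ℕ, ∀ ρ ∈ Set.Icc (0 : ℝ) 1, ∀ c ∈ Set.Icc (0 : ℝ) 1,
      M k ρ c =
        (prodBernoulli (fun i : Site 2 × Fin 2 × Fin 3 =>
            if i.2.2 = 0 then (if ax k (i.1, i.2.1) then half else Set.projIcc (0 : ℝ) 1 zero_le_one c)
            else if i.2.2 = 1 then Set.projIcc (0 : ℝ) 1 zero_le_one (ρ / 2)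
            else Set.projIcc (0 : ℝ) 1 zero_le_one ((2 - 2 * ρ) / (2 - ρ)))).map
          (fun S : Set (Site 2 × Fin 2 × Fin 3) =>
            ({e | ∃ (v : Site 2) (d : Fin 2), e = s(v, v + (if d = 0 then ![1, 0] else ![0, 1])) ∧
                (if ax k (v, d) then ((tb k (v, d), d, (1 : Fin 3)) ∈ S ∨
                    ((tb k (v, d), d, (2 : Fin 3)) ∈ S ∧ (v, d, (0 : Fin 3)) ∈ S))
                  else (v, d, (0 : Fin 3)) ∈ S)} : BondConfig (Site 2))) :=
  _root_.Summit.CriticalPhenomena.CardyFormulaZ2.Theorems.CardySelfRefinement.stub_monotoneRep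

/-- **STUB 2a · `stub_layerLocalModification`** (NEW r4; L; deterministic planar-lattice topology — the boundary LAYER
surgery behind Stage D of the slope bounds): for every finite quad family there are a range `R`, a layer width `r₅` and a
mesh threshold `η₅` such that, at mesh `η < η₅`, whenever an AXIAL edge with an end `r₅`-near a quad side is pivotal for
the localised joint crossing event at `ω`, some NON-axial edge within `R` of it is pivotal after modifying `ω` on genuine
edges within `R` (free-cell detour / bridge ⇒ crosscut ⇒ cell-contact path; `Lines/…-axialLayer-report.md` §Q1
(S1)–(S5), gaps (G1)–(G3)).  With finite energy of `M_k` it gives the layer bound (D)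
(`axialLayer_pivotal_le_of_layerModification`, p150676). -/
theorem stub_layerLocalModification :
    ∀ k : ℕ, k = 2 ∨ k = 3 → ∀ (m : ℕ) (F : Fin m → Quad (Set.univ : Set ℂ)), 0 < m →
      ∃ (R : ℕ) (r₅ η₅ : ℝ), 0 < r₅ ∧ 0 < η₅ ∧ ∀ η ∈ Set.Ioo 0 η₅, ∀ (v : Site 2) (d : Fin 2), ax k (v, d) →
        (∃ x ∈ edgeOf (v, d), ∃ (i : Fin m) (j : Fin 4), ∃ p ∈ (F i).side j,
          dist ((η : ℂ) * squareLatticeEmbedding.z x) p < r₅) →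
        ∀ ω : BondConfig (Site 2), IsPivotal (Aloc m F η) (edgeOf (v, d)) ω →
          ∃ (Rm S : Set (Sym2 (Site 2))) (e' : Sym2 (Site 2)),
            (∃ (v' : Site 2) (d' : Fin 2), e' = edgeOf (v', d') ∧ ¬ ax k (v', d') ∧ ∀ i, |v' i - v i| ≤ (R : ℤ)) ∧
            (∀ x ∈ Rm ∪ S, ∃ a b : Site 2, x = s(a, b) ∧ (zdGraph 2).Adj a b ∧
              ∀ i, |a i - v i| ≤ (R : ℤ) ∧ |b i - v i| ≤ (R : ℤ)) ∧
            IsPivotal (Aloc m F η) e' ((ω \ Rm) ∪ S) := by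
  sorry

/-- **STUB 2b′ · `stub_cornerLayer2`** (NEW r7; the corner boundary LAYER for `k = 2`, (LAYER₂) of `Lines/…-loc-report.md`): on the
corner band with `c ≤ c₁`, the defect mass of the selectors whose bundle is NOT `r`-far from the quad sides plus the pivotal mass of the
NON-far interior edges is at most `θ < 1` times the jointly-pivotal mass `N_far` of the far selectors (an arm-lite boundary count; blocked for
wild Jordan quads, plausible-cheap for polygonal ones). -/
theorem stub_cornerLayer2 :
    ∀ k : ℕ, k = 2 → ∀ (m : ℕ) (F : Fin m → Quad (Set.univ : Set ℂ)), 0 < m → ∃ δ c₁ θ : ℝ, 0 < δ ∧ 0 < c₁ ∧ θ <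
      1 ∧ ∀ vlo vhi : ℝ, 0 < vlo → vlo < vhi → vhi < 1 → ∃ η₀ : ℝ, 0 < η₀ ∧ ∀ η ∈ Set.Ioo 0 η₀, ∀ ρ ∈ Set.Icc (1
      - 2 * δ) 1, ∀ c ∈ Set.Icc (0 : ℝ) c₁, P k m F η ρ c ∈ Set.Icc vlo vhi → ∃ r r' : ℝ, 20 * η ≤ r ∧ r + 6 * η
      ≤ r' ∧ ∀ (K S : Finset (Site 2 × Fin 2 × Fin 3)), (↑K : Set (Site 2 × Fin 2 × Fin 3)) = coinWindow k
      (window m F η) → (∀ i, i ∈ S ↔ i ∈ K ∧ i.2.2 = 2 ∧ ∀ j : ℕ, 0 < j → j < k → ∀ (a : Fin m) (b : Fin 4), ∀ p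
      ∈ (F a).side b, r ≤ dist ((η : ℂ) * squareLatticeEmbedding.z (fun l => (k : ℤ) * i.1 l + if l = i.2.1 then
      (j : ℤ) else 0)) p) → ∀ VL : Finset (Site 2 × Fin 2), (∀ vd, vd ∈ VL ↔ (edgeOf vd ∈ window m F η ∧ ¬ ax k
      vd) ∧ ∃ x ∈ edgeOf vd, ∃ (a : Fin m) (b : Fin 4), ∃ p ∈ (F a).side b, dist ((η : ℂ) *
      squareLatticeEmbedding.z x) p < r') → ∑ i ∈ K.filter (fun i => i.2.2 = 2) \ S, (M k ρ c).real {ω | ω ∪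
      edgeOf '' {vd : Site 2 × Fin 2 | ax k vd ∧ tb k vd = i.1 ∧ vd.2 = i.2.1} ∈ Aloc m F η ∧ ω \ edgeOf '' {vd
      : Site 2 × Fin 2 | ax k vd ∧ tb k vd = i.1 ∧ vd.2 = i.2.1} ∉ Aloc m F η} + ∑ vd ∈ VL, (M k ρ c).real {ω |
      IsPivotal (Aloc m F η) (edgeOf vd) ω} ≤ θ * ∑ i ∈ S, (M k ρ c).real {ω | ω ∪ edgeOf '' {vd : Site 2 × Fin
      2 | ax k vd ∧ tb k vd = i.1 ∧ vd.2 = i.2.1} ∈ Aloc m F η ∧ ω \ edgeOf '' {vd : Site 2 × Fin 2 | ax k vd ∧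
      tb k vd = i.1 ∧ vd.2 = i.2.1} ∉ Aloc m F η} := by
  sorry

/-- **STUB 2b″ · `stub_cornerLayer3`** (NEW r7; the same boundary-layer count for `k = 3`, (LAYER₃): radii `r + 9η ≤ r'`). -/
theorem stub_cornerLayer3 :
    ∀ k : ℕ, k = 3 → ∀ (m : ℕ) (F : Fin m → Quad (Set.univ : Set ℂ)), 0 < m → ∃ δ c₁ θ : ℝ, 0 < δ ∧ 0 < c₁ ∧ θ <
      1 ∧ ∀ vlo vhi : ℝ, 0 < vlo → vlo < vhi → vhi < 1 → ∃ η₀ : ℝ, 0 < η₀ ∧ ∀ η ∈ Set.Ioo 0 η₀, ∀ ρ ∈ Set.Icc (1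
      - 2 * δ) 1, ∀ c ∈ Set.Icc (0 : ℝ) c₁, P k m F η ρ c ∈ Set.Icc vlo vhi → ∃ r r' : ℝ, 20 * η ≤ r ∧ r + 9 * η
      ≤ r' ∧ ∀ (K S : Finset (Site 2 × Fin 2 × Fin 3)), (↑K : Set (Site 2 × Fin 2 × Fin 3)) = coinWindow k
      (window m F η) → (∀ i, i ∈ S ↔ i ∈ K ∧ i.2.2 = 2 ∧ ∀ j : ℕ, 0 < j → j < k → ∀ (a : Fin m) (b : Fin 4), ∀ p
      ∈ (F a).side b, r ≤ dist ((η : ℂ) * squareLatticeEmbedding.z (fun l => (k : ℤ) * i.1 l + if l = i.2.1 then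
      (j : ℤ) else 0)) p) → ∀ VL : Finset (Site 2 × Fin 2), (∀ vd, vd ∈ VL ↔ (edgeOf vd ∈ window m F η ∧ ¬ ax k
      vd) ∧ ∃ x ∈ edgeOf vd, ∃ (a : Fin m) (b : Fin 4), ∃ p ∈ (F a).side b, dist ((η : ℂ) *
      squareLatticeEmbedding.z x) p < r') → ∑ i ∈ K.filter (fun i => i.2.2 = 2) \ S, (M k ρ c).real {ω | ω ∪
      edgeOf '' {vd : Site 2 × Fin 2 | ax k vd ∧ tb k vd = i.1 ∧ vd.2 = i.2.1} ∈ Aloc m F η ∧ ω \ edgeOf '' {vd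
      : Site 2 × Fin 2 | ax k vd ∧ tb k vd = i.1 ∧ vd.2 = i.2.1} ∉ Aloc m F η} + ∑ vd ∈ VL, (M k ρ c).real {ω |
      IsPivotal (Aloc m F η) (edgeOf vd) ω} ≤ θ * ∑ i ∈ S, (M k ρ c).real {ω | ω ∪ edgeOf '' {vd : Site 2 × Fin
      2 | ax k vd ∧ tb k vd = i.1 ∧ vd.2 = i.2.1} ∈ Aloc m F η ∧ ω \ edgeOf '' {vd : Site 2 × Fin 2 | ax k vd ∧
      tb k vd = i.1 ∧ vd.2 = i.2.1} ∉ Aloc m F η} := by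
  sorry

/-- **STUB 2b · `stub_cornerLocalSlope`** — DISCHARGED (r7) from `stub_cornerLayer2` / `stub_cornerLayer3` by the landed
`cornerLocalSlope_of_layerTerms` (p166125); (LOC) of
`Lines/…-slopeBoundsCorner-report.md`): for some depth `δ` and some `c₀ > 0` (independent of the levels), on the corner
band with `c ≤ c₀` one has `|∂cP| ≤ C·|∂ρP|` mesh-uniformly (currency `N_PIV`; exact identity
`Dρ = (½−2^{-k})N_PIV − 2^{-k}PEN`, penalty bound and corner transfer by cheap tie-moves — closed on paper for `k = 2`,
one quad, graph semantics; the corner boundary layer needs arm bounds for wild quads). -/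
theorem stub_cornerLocalSlope :
    ∀ k : ℕ, k = 2 ∨ k = 3 → ∀ (m : ℕ) (F : Fin m → Quad (Set.univ : Set ℂ)), 0 < m →
      ∃ δ c₀ : ℝ, 0 < δ ∧ 0 < c₀ ∧ ∀ vlo vhi : ℝ, 0 < vlo → vlo < vhi → vhi < 1 →
        ∃ C η₁ : ℝ, 0 < η₁ ∧ ∀ η ∈ Set.Ioo 0 η₁, ∀ ρ ∈ Set.Icc (1 - 2 * δ) 1,
          ∀ c ∈ Set.Icc (0 : ℝ) c₀, P k m F η ρ c ∈ Set.Icc vlo vhi →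
            |Dc k m F η (ρ, c)| ≤ C * |Dρ k m F η (ρ, c)| :=
  cornerLocalSlope_of_layerTerms stub_cornerLayer2 stub_cornerLayer3

/-- **STUB 2c · `stub_cornerHardWayBoxes`** — **LANDED** (`Theorems/…StubCornerHardWayBoxes.lean`, p163128; Aizenman–Grimmett
essential enhancement at the corner, (HWB) of `Lines/…-slopeBoundsCorner-report.md`): for every `c₀ > 0` there is a depth
`δ` such that the hard-way box crossings of aspect ratio 8 under `M_k(ρ, c₀)`, `ρ ∈ [1−2δ, 1]`, tend to `1` uniformly
(the interior edges are an essential enhancement of critical coarse percolation; with `cornerConfinement_of_hardWayBoxes`,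
p147063, it confines the corner level band to `c ≤ c₀`). -/
theorem stub_cornerHardWayBoxes :
    ∀ k : ℕ, k = 2 ∨ k = 3 → ∀ c₀ : ℝ, 0 < c₀ → ∃ δ : ℝ, 0 < δ ∧ ∀ ε : ℝ, 0 < ε → ∃ n₀ : ℕ,
      ∀ n : ℕ, n₀ ≤ n → ∀ w : ℂ, ∀ ρ ∈ Set.Icc (1 - 2 * δ) 1,
        1 - ε ≤ (M k ρ c₀).real (embRectCrossing (fun v => squareLatticeEmbedding.z v - w) (8 * n) n) ∧
        1 - ε ≤ (M k ρ c₀).real (embTBCrossing (fun v => squareLatticeEmbedding.z v - w) n (8 * n)) :=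
  _root_.Summit.CriticalPhenomena.CardyFormulaZ2.Theorems.CardySelfRefinement.stub_cornerHardWayBoxes

/-- **STUB 2 · `stub_slopeBounds`** — DISCHARGED (r4) from `stub_layerLocalModification`, `stub_cornerLocalSlope`,
`stub_cornerHardWayBoxes` by the landed reductions (history: landed ingredients: bundle surgery p141399, Stage A
`Drho_abs_le_sum_axial_pivotal` p142276 (`|Dρ| ≤ (2^k/δ)·Σ_{axial window e} M(e pivotal)`), finite energy of `M_k`
p142713, modification cost p144399, Stage B bulk transfer `nonAxialShare_bulk_M` (written); REMAINING for the bulk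
clause: (C) `c`-range at bulk path points, (D) the boundary-layer bound for wild Jordan quads; corner clause open).
From `stub_monotoneRep`: (bulk) at path points with `ρ_s ≤ 1 − δ`, `|∂ρP| ≤ C_δ · ∂cP` mesh-uniformly; (corner) for
some depth `δ ≤ ¼`, on the corner level band `|∂cP| ≤ C′ · |∂ρP|` mesh-uniformly. -/
theorem stub_slopeBounds :
    (∀ k : ℕ, ∀ ρ ∈ Set.Icc (0 : ℝ) 1, ∀ c ∈ Set.Icc (0 : ℝ) 1,
      M k ρ c =
        (prodBernoulli (fun i : Site 2 × Fin 2 × Fin 3 =>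
            if i.2.2 = 0 then (if ax k (i.1, i.2.1) then half else Set.projIcc (0 : ℝ) 1 zero_le_one c)
            else if i.2.2 = 1 then Set.projIcc (0 : ℝ) 1 zero_le_one (ρ / 2)
            else Set.projIcc (0 : ℝ) 1 zero_le_one ((2 - 2 * ρ) / (2 - ρ)))).map
          (fun S : Set (Site 2 × Fin 2 × Fin 3) =>
            ({e | ∃ (v : Site 2) (d : Fin 2), e = s(v, v + (if d = 0 then ![1, 0] else ![0, 1])) ∧
                (if ax k (v, d) then ((tb k (v, d), d, (1 : Fin 3)) ∈ S ∨
                    ((tb k (v, d), d, (2 : Fin 3)) ∈ S ∧ (v, d, (0 : Fin 3)) ∈ S))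
                  else (v, d, (0 : Fin 3)) ∈ S)} : BondConfig (Site 2)))) →
    ∀ k : ℕ, k = 2 ∨ k = 3 → ∀ γ : unitInterval → ℝ × ℝ, PathOK k γ →
      ∀ (m : ℕ) (F : Fin m → Quad (Set.univ : Set ℂ)), 0 < m →
        (∀ δ : ℝ, 0 < δ → δ ≤ 1 / 2 → ∃ C η₁ : ℝ, 0 < η₁ ∧ ∀ η ∈ Set.Ioo 0 η₁, ∀ s : unitInterval,
            (γ s).1 ≤ 1 - δ → |Dρ k m F η (γ s)| ≤ C * Dc k m F η (γ s)) ∧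
        (∃ δ : ℝ, 0 < δ ∧ δ ≤ 1 / 4 ∧ ∀ vlo vhi : ℝ, 0 < vlo → vlo < vhi → vhi < 1 →
            ∃ C η₁ : ℝ, 0 < η₁ ∧ ∀ η ∈ Set.Ioo 0 η₁, ∀ ρ ∈ Set.Icc (1 - 2 * δ) 1,
              ∀ c ∈ Set.Icc (0 : ℝ) 1, P k m F η ρ c ∈ Set.Icc vlo vhi →
                |Dc k m F η (ρ, c)| ≤ C * |Dρ k m F η (ρ, c)|) :=
  fun _hMR k hk γ hγ m F hm =>
    ⟨fun δ hδ hδ' =>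
      slopeBounds_bulk_of_cRange_of_layerBound bulkPathPoints_cRange
        (fun k' hk' m' F' hm' =>
          axialLayer_pivotal_le_of_layerModification k' hk' m' F' hm' (stub_layerLocalModification k' hk' m' F' hm'))
        k hk γ hγ m F hm δ hδ hδ',
      slopeBounds_corner_of_localSlope_of_confinement stub_cornerLocalSlope
        (cornerConfinement_of_hardWayBoxes stub_cornerHardWayBoxes) k hk γ hγ m F hm⟩

/-- **STUB 3 · `stub_bet`** (THE BET; open conjecture, crux-sized, = the registered
`Sketch.stub_transversalSlopeLipschitz` verbatim; the route's rank-2 mechanism at second order; MC-supported at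
`k = 2` in the 1-dependent regime (`MC-BetVerdict-1dep.md`); held by the lead — `k = 3` falsifier `mc/main.py`). -/
theorem stub_bet :
    ∀ k : ℕ, k = 2 ∨ k = 3 → ∀ γ : unitInterval → ℝ × ℝ, PathOK k γ →
      ∀ (m : ℕ) (F : Fin m → Quad (Set.univ : Set ℂ)), 0 < m → ∀ δ : ℝ, 0 < δ → δ ≤ 1 / 2 →
        ∀ vlo vhi : ℝ, 0 < vlo → vlo < vhi → vhi < 1 →
          ∃ Θ η₁ : ℝ, 0 ≤ Θ ∧ 0 < η₁ ∧ ∀ η ∈ Set.Ioo 0 η₁, ∀ ρ ∈ Set.Icc (0 : ℝ) (1 - δ),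
            ∀ c ∈ Set.Icc (0 : ℝ) 1, ∀ c' ∈ Set.Icc (0 : ℝ) 1,
              P k m F η ρ c ∈ Set.Icc vlo vhi → P k m F η ρ c' ∈ Set.Icc vlo vhi →
                |Dρ k m F η (ρ, c) / Dc k m F η (ρ, c) - Dρ k m F η (ρ, c') / Dc k m F η (ρ, c')| ≤
                  Θ * |c - c'| := by
  sorry

/-- **STUB 4 · `stub_cornerBetW`** (r5; open conjecture — the corner twin of THE BET in its weakest consumed, POINTWISE form (W):
for some depth `δ ≤ ¼`, at every point of the corner level band `{ρ ∈ [1−2δ,1], P_η(ρ,c) ∈ [vlo,vhi]}` the `ρ`-derivative does not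
vanish and every one-sided derivative `S'` of `r ↦ Dc/Dρ (r, c)` within `[0,1]` at `ρ` has `|S'| ≤ Θ`, `Θ` mesh-uniform; MC-supported at
`k = 2` (audit `Lines/…-cornerBet-audit.md`); `k = 2, 3` window jobs j025653/j025654.  Replaces the two-point form `stub_cornerBet`
(R ⇒ W; the landed corner transport consumes only W: `stub_levelSetTransport_of_pointwiseCornerBet`, p152361). -/
theorem stub_cornerBetW :
    ∀ k : ℕ, k = 2 ∨ k = 3 → ∀ γ : unitInterval → ℝ × ℝ, PathOK k γ → ∀ (m : ℕ) (F : Fin m → Quad (Set.univ :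
      Set ℂ)), 0 < m → ∃ δ : ℝ, 0 < δ ∧ δ ≤ 1 / 4 ∧ ∀ vlo vhi : ℝ, 0 < vlo → vlo < vhi → vhi < 1 → ∃ Θ η₁ : ℝ, 0
      ≤ Θ ∧ 0 < η₁ ∧ ∀ η ∈ Set.Ioo 0 η₁, ∀ c ∈ Set.Icc (0 : ℝ) 1, ∀ ρ ∈ Set.Icc (1 - 2 * δ) 1, P k m F η ρ c ∈
      Set.Icc vlo vhi → Dρ k m F η (ρ, c) ≠ 0 ∧ ∀ S' : ℝ, HasDerivWithinAt (fun r => Dc k m F η (r, c) / Dρ k m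
      F η (r, c)) S' (Set.Icc 0 1) ρ → |S'| ≤ Θ := by
  sorry

/-- **STUB 5′ · `stub_sliceKesten`** (NEW r3; L; Bernoulli-class) — **Kesten's near-critical stability on the
independent slice `ρ = 0`**, stated on the product measure itself: for the `k`-periodic inhomogeneous INDEPENDENT bond
model `μ_c` on `ℤ²` (axial edges — on the lines of `kℤ²` — open with probability `½`, all other edges with probability
`c`), across the finite-size level window `{c : μ_c(Aloc) ∈ [vlo, vhi]}` of the joint quad event at mesh `η`, the sum
over the non-axial window edges of the pivotality probabilities varies by at most a mesh-uniform factor `Λ`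
(Kesten 1987 Thm 1 / Lemma 8; Nolin 2008 Thm 27; DMT arXiv:2111.14414 Thm 1.2).  EQUIVALENT to the old
`stub_windowAtRhoZero` (`stub_windowAtRhoZero_of_sliceStability`, `sliceStability_of_windowAtRhoZero`, p141185).
The homogeneous cousin `Literature.Probability.Percolation.Kesten1987_zdFourArmStability` is an unproved named fact. -/
theorem stub_sliceKesten :
    ∀ k : ℕ, k = 2 ∨ k = 3 → ∀ μ : ℝ → Measure (BondConfig (Site 2)),
      (∀ c, μ c = (prodBernoulli fun e : Site 2 × Fin 2 =>
        if ax k e then half else Set.projIcc (0 : ℝ) 1 zero_le_one c).map edgeConfig) →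
      ∀ (m : ℕ) (F : Fin m → Quad (Set.univ : Set ℂ)), 0 < m →
        ∀ vlo vhi : ℝ, 0 < vlo → vlo < vhi → vhi < 1 →
          ∃ Λ η₁ : ℝ, 0 < η₁ ∧ ∀ η ∈ Set.Ioo 0 η₁, ∀ W : Finset (Sym2 (Site 2)),
            (∀ e, e ∈ W ↔ e ∈ window m F η ∧
              ∃ (v : Site 2) (d : Fin 2), e = edgeOf (v, d) ∧ ¬ ax k (v, d)) →
            ∀ c ∈ Set.Icc (0 : ℝ) 1, ∀ c' ∈ Set.Icc (0 : ℝ) 1,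
              (μ c).real (Aloc m F η) ∈ Set.Icc vlo vhi → (μ c').real (Aloc m F η) ∈ Set.Icc vlo vhi →
                ∑ e ∈ W, (μ c).real {ω | IsPivotal (Aloc m F η) e ω} ≤
                  Λ * ∑ e ∈ W, (μ c').real {ω | IsPivotal (Aloc m F η) e ω} := by
  sorry

/-- **STUB 6′ · `stub_cornerWindows`** (NEW r3; L; Bernoulli-class) — **the two Kesten windows through the independent
corner `(1,0)`**: (h0) on the slice `{c = 0}` (`M_k(ρ,0)` = Bernoulli bond percolation on the coarse lattice `kℤ²` with
`p(ρ) = ρ/2 + (1−ρ)2^{-k}`, critical at `ρ = 1`) and (h1) on the slice `{ρ = 1}` (tied bundles + independent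
Bernoulli(`c`) cell interiors, critical at `c = 0`), every band point `{P_η ∈ [vlo,vhi]}` has `|Dρ|` comparable, up to a
mesh-uniform `C`, with `|Dρ(1,0)|` at the critical corner itself (Kesten 1987 Lemma 8 with monotone legs; the `{c = 0}`
half is the quad-family form of `Kesten1987_zdFourArmStability` + `Kesten1987_zdPivotalCount_sameParam` in `M_k`
clothing).  IMPLIES the old `stub_cornerPatch` (`stub_cornerPatch_of_sliceWindows`, p141084, `Λ = C²`). -/
theorem stub_cornerWindows :
    (∀ k : ℕ, k = 2 ∨ k = 3 → ∀ (m : ℕ) (F : Fin m → Quad (Set.univ : Set ℂ)), 0 < m →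
      ∀ vlo vhi : ℝ, 0 < vlo → vlo < vhi → vhi < 1 →
        ∃ C η₁ : ℝ, 0 < η₁ ∧ ∀ η ∈ Set.Ioo 0 η₁, ∀ ρ ∈ Set.Icc (0 : ℝ) 1,
          P k m F η ρ 0 ∈ Set.Icc vlo vhi →
            |Dρ k m F η (ρ, 0)| ≤ C * |Dρ k m F η (1, 0)| ∧
              |Dρ k m F η (1, 0)| ≤ C * |Dρ k m F η (ρ, 0)|) ∧
    (∀ k : ℕ, k = 2 ∨ k = 3 → ∀ (m : ℕ) (F : Fin m → Quad (Set.univ : Set ℂ)), 0 < m →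
      ∀ vlo vhi : ℝ, 0 < vlo → vlo < vhi → vhi < 1 →
        ∃ C η₁ : ℝ, 0 < η₁ ∧ ∀ η ∈ Set.Ioo 0 η₁, ∀ c ∈ Set.Icc (0 : ℝ) 1,
          P k m F η 1 c ∈ Set.Icc vlo vhi →
            |Dρ k m F η (1, c)| ≤ C * |Dρ k m F η (1, 0)| ∧
              |Dρ k m F η (1, 0)| ≤ C * |Dρ k m F η (1, c)|) := by
  sorry

/-- **STUB 5 · `stub_cornerPatch`** — DISCHARGED (r3) from `stub_cornerWindows` by the landed reduction
`stub_cornerPatch_of_sliceWindows` (p141084): across the level band on the two slices through `(1,0)` the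
`ρ`-derivative is comparable up to one mesh-uniform constant. -/
theorem stub_cornerPatch :
    ∀ k : ℕ, k = 2 ∨ k = 3 → ∀ (m : ℕ) (F : Fin m → Quad (Set.univ : Set ℂ)), 0 < m →
      ∀ vlo vhi : ℝ, 0 < vlo → vlo < vhi → vhi < 1 →
        ∃ Λ η₁ : ℝ, 0 < η₁ ∧ ∀ η ∈ Set.Ioo 0 η₁,
          ∀ q ∈ Set.Icc (0 : ℝ) 1 ×ˢ Set.Icc (0 : ℝ) 1, ∀ q' ∈ Set.Icc (0 : ℝ) 1 ×ˢ Set.Icc (0 : ℝ) 1,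
            (q.1 = 1 ∨ q.2 = 0) → (q'.1 = 1 ∨ q'.2 = 0) →
              P k m F η q.1 q.2 ∈ Set.Icc vlo vhi → P k m F η q'.1 q'.2 ∈ Set.Icc vlo vhi →
                |Dρ k m F η q| ≤ Λ * |Dρ k m F η q'| :=
  _root_.Summit.CriticalPhenomena.CardyFormulaZ2.Theorems.CardySelfRefinement.stub_cornerPatch_of_sliceWindows
    stub_cornerWindows.1 stub_cornerWindows.2

/-- **STUB 6 · `stub_levelSetTransport`** — **LANDED** (`Theorems/…StubLevelSetTransport.lean`, p139940): THE BET, the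
corner BET and the corner patch transport the gradient inside level sets (identity (★) along the leaves). -/
theorem stub_levelSetTransport :
    (∀ k : ℕ, k = 2 ∨ k = 3 → ∀ γ : unitInterval → ℝ × ℝ, PathOK k γ →
      ∀ (m : ℕ) (F : Fin m → Quad (Set.univ : Set ℂ)), 0 < m → ∀ δ : ℝ, 0 < δ → δ ≤ 1 / 2 →
        ∀ vlo vhi : ℝ, 0 < vlo → vlo < vhi → vhi < 1 →
          ∃ Θ η₁ : ℝ, 0 ≤ Θ ∧ 0 < η₁ ∧ ∀ η ∈ Set.Ioo 0 η₁, ∀ ρ ∈ Set.Icc (0 : ℝ) (1 - δ),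
            ∀ c ∈ Set.Icc (0 : ℝ) 1, ∀ c' ∈ Set.Icc (0 : ℝ) 1,
              P k m F η ρ c ∈ Set.Icc vlo vhi → P k m F η ρ c' ∈ Set.Icc vlo vhi →
                |Dρ k m F η (ρ, c) / Dc k m F η (ρ, c) - Dρ k m F η (ρ, c') / Dc k m F η (ρ, c')| ≤
                  Θ * |c - c'|) →
    (∀ k : ℕ, k = 2 ∨ k = 3 → ∀ γ : unitInterval → ℝ × ℝ, PathOK k γ →
      ∀ (m : ℕ) (F : Fin m → Quad (Set.univ : Set ℂ)), 0 < m →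
        ∃ δ : ℝ, 0 < δ ∧ δ ≤ 1 / 4 ∧ ∀ vlo vhi : ℝ, 0 < vlo → vlo < vhi → vhi < 1 →
          ∃ Θ η₁ : ℝ, 0 ≤ Θ ∧ 0 < η₁ ∧ ∀ η ∈ Set.Ioo 0 η₁, ∀ c ∈ Set.Icc (0 : ℝ) 1,
            ∀ ρ ∈ Set.Icc (1 - 2 * δ) 1, ∀ ρ' ∈ Set.Icc (1 - 2 * δ) 1,
              P k m F η ρ c ∈ Set.Icc vlo vhi → P k m F η ρ' c ∈ Set.Icc vlo vhi →
                Dρ k m F η (ρ, c) ≠ 0 ∧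
                |Dc k m F η (ρ, c) / Dρ k m F η (ρ, c) - Dc k m F η (ρ', c) / Dρ k m F η (ρ', c)| ≤
                  Θ * |ρ - ρ'|) →
    (∀ k : ℕ, k = 2 ∨ k = 3 → ∀ (m : ℕ) (F : Fin m → Quad (Set.univ : Set ℂ)), 0 < m →
      ∀ vlo vhi : ℝ, 0 < vlo → vlo < vhi → vhi < 1 →
        ∃ Λ η₁ : ℝ, 0 < η₁ ∧ ∀ η ∈ Set.Ioo 0 η₁,
          ∀ q ∈ Set.Icc (0 : ℝ) 1 ×ˢ Set.Icc (0 : ℝ) 1, ∀ q' ∈ Set.Icc (0 : ℝ) 1 ×ˢ Set.Icc (0 : ℝ) 1,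
            (q.1 = 1 ∨ q.2 = 0) → (q'.1 = 1 ∨ q'.2 = 0) →
              P k m F η q.1 q.2 ∈ Set.Icc vlo vhi → P k m F η q'.1 q'.2 ∈ Set.Icc vlo vhi →
                |Dρ k m F η q| ≤ Λ * |Dρ k m F η q'|) →
    ∀ k : ℕ, k = 2 ∨ k = 3 → ∀ γ : unitInterval → ℝ × ℝ, PathOK k γ →
      ∀ (m : ℕ) (F : Fin m → Quad (Set.univ : Set ℂ)), 0 < m →
        (∀ δ : ℝ, 0 < δ → δ ≤ 1 / 2 → ∀ vlo vhi : ℝ, 0 < vlo → vlo < vhi → vhi < 1 →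
          ∃ Λ η₁ : ℝ, 0 < η₁ ∧ ∀ η ∈ Set.Ioo 0 η₁,
            ∀ ρ₀ ∈ Set.Icc (0 : ℝ) (1 - δ), ∀ c₀ ∈ Set.Icc (0 : ℝ) 1,
            ∀ ρ₁ ∈ Set.Icc (0 : ℝ) (1 - δ), ∀ c₁ ∈ Set.Icc (0 : ℝ) 1,
              P k m F η ρ₀ c₀ ∈ Set.Icc vlo vhi → P k m F η ρ₁ c₁ = P k m F η ρ₀ c₀ →
                Dc k m F η (ρ₁, c₁) ≤ Λ * Dc k m F η (ρ₀, c₀)) ∧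
        (∃ δ : ℝ, 0 < δ ∧ δ ≤ 1 / 4 ∧ ∀ vlo vhi : ℝ, 0 < vlo → vlo < vhi → vhi < 1 →
          ∃ Λ η₁ : ℝ, 0 < η₁ ∧ ∀ η ∈ Set.Ioo 0 η₁,
            ∀ ρ₀ ∈ Set.Icc (1 - 2 * δ) 1, ∀ c₀ ∈ Set.Icc (0 : ℝ) 1,
            ∀ ρ₁ ∈ Set.Icc (1 - 2 * δ) 1, ∀ c₁ ∈ Set.Icc (0 : ℝ) 1,
              P k m F η ρ₀ c₀ ∈ Set.Icc vlo vhi → P k m F η ρ₁ c₁ = P k m F η ρ₀ c₀ →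
                |Dρ k m F η (ρ₁, c₁)| ≤ Λ * |Dρ k m F η (ρ₀, c₀)|) :=
  _root_.Summit.CriticalPhenomena.CardyFormulaZ2.Theorems.CardySelfRefinement.stub_levelSetTransport

/-- **STUB 7 · `stub_windowAtRhoZero`** — DISCHARGED (r3) from `stub_sliceKesten` by the landed reduction
`stub_windowAtRhoZero_of_sliceStability` (p141185): across the level window of the independent slice `ρ = 0` the Russo
derivative `∂cP(0,·)` varies by at most a mesh-uniform factor. -/
theorem stub_windowAtRhoZero :
    ∀ k : ℕ, k = 2 ∨ k = 3 → ∀ (m : ℕ) (F : Fin m → Quad (Set.univ : Set ℂ)), 0 < m →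
      ∀ vlo vhi : ℝ, 0 < vlo → vlo < vhi → vhi < 1 →
        ∃ Λ η₁ : ℝ, 0 < η₁ ∧ ∀ η ∈ Set.Ioo 0 η₁, ∀ c ∈ Set.Icc (0 : ℝ) 1, ∀ c' ∈ Set.Icc (0 : ℝ) 1,
          P k m F η 0 c ∈ Set.Icc vlo vhi → P k m F η 0 c' ∈ Set.Icc vlo vhi →
            Dc k m F η (0, c) ≤ Λ * Dc k m F η (0, c') :=
  _root_.Summit.CriticalPhenomena.CardyFormulaZ2.Theorems.CardySelfRefinement.stub_windowAtRhoZero_of_sliceStability stub_sliceKesten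

/-! ### Consistency: each named statement IS its registered stub (definitionally) -/

theorem monotoneRep_holds : MonotoneRep := stub_monotoneRep
theorem slopeBounds_holds : MonotoneRep → SlopeBounds := stub_slopeBounds
theorem transversalSlopeLipschitz_holds : TransversalSlopeLipschitz := stub_bet
theorem cornerPatch_holds : CornerPatch := stub_cornerPatch
theorem levelSetTransport_holds :
    TransversalSlopeLipschitz → CornerSlopeLipschitz → CornerPatch → LevelSetComparability :=
  stub_levelSetTransport
theorem windowAtRhoZero_holds : WindowAtRhoZero := stub_windowAtRhoZero

/-! ## §4 The composition: the stubs imply the crux BY NAME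

The glue (bulk chart = slope bound ⨉ level-set comparability ⨉ window at `ρ = 0`; corner chart = slope bound ⨉
level-set comparability ⨉ patch; overlap of the charts by the IVT along the path; clause (ii) from clause (i) and
`divergesAt_zero_half`) is LANDED as `Theorems/…OfMonotoneLine.lean` + `…OfMonotoneLineCharts.lean`
(`GradientComparability_of_monotoneLine`, p142722 / p141441); here it is applied to the stubs of §3. -/

/-- **The crux `GradientComparability`** (route `CardySelfRefinement`, stmt-CriticalPhenomena-10269), BY NAME, from the
registered stubs of the line `monotone-product-coordinates` through the landed composition
`GradientComparability_of_monotoneLineW` (closed modulo the `sorry`s inside `stub_bet`, `stub_cornerBetW`,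
`stub_sliceKesten`, `stub_cornerWindows`, `stub_layerLocalModification`, `stub_cornerLayer2`, `stub_cornerLayer3` only). -/
theorem GradientComparability_proof : GradientComparability :=
  GradientComparability_of_monotoneLineW stub_monotoneRep stub_slopeBounds stub_bet stub_cornerBetW stub_cornerPatch
    stub_windowAtRhoZero

end Summit.CriticalPhenomena.CardyFormulaZ2.Cruxes.GradientComparability.MonotoneProductCoordinates

end
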